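import Literature.NumberTheory.EllipticCurves.GreenbergSelmerOrdinaryFiltrationProofs
import Literature.NumberTheory.EllipticCurves.EisensteinNewformLevelRaisingOrdinaryUnitRootSpecializationProofs
import Mathlib.LinearAlgebra.FreeModule.PID
import HarnessLib

/-!
# An ordinary filtration over a principal ideal domain comes from an INTEGRAL ORDINARY FRAME (proofs only)

Topic `NumberTheory/EllipticCurves` (namespace `Literature.NumberTheory.EllipticCurves.GreenbergSelmer`). THEOREMS ONLY (no definition,
no named fact; D-0026). Converse of the tree's `OrdinaryFiltration.exists_ofIntegralFrame` (frame ⟹ filtration): for a framed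
representation `ρ : Γ_K → GL₂(𝒪)` over a principal ideal DOMAIN `𝒪` and an `OrdinaryFiltration ρ v` (`T⁺` a rank-one direct summand of
`𝒪²`, `Γ_{K_v}`-stable, with unramified quotient), the summand `T⁺` and a complement are free of rank one (submodules of a free
module over a PID, `Submodule.basisOfPid`); their generators form a basis `(ℓ, c)` of `𝒪²`, i.e. an integral frame `Q₀ = (ℓ | c) ∈
GL₂(𝒪)`, in which every `ρ(σ)`, `σ ∈ Γ_{K_v}`, is upper triangular (`ρ(σ)ℓ ∈ 𝒪ℓ`) with lower-right entry `1` on the inertia group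
(`ρ(σ)c − c ∈ 𝒪ℓ`). Greenberg 1989 p. 98 (1)/(4) read on a basis adapted to `F⁺T_p`; EPW §3.1 (eq:ordes).

* `OrdinaryFiltration.exists_integralFrame` — the statement above.

Use: cell `bsd-stepL`, crux 25505, stub (FIX): the integral ordinary frame of `Δ.ρ` at `w = (p)` from the datum's `Δ.fil w hw`
(`𝒪 = padicCoeffIntegers ι` is a PID, `isPrincipalIdealRing_padicCoeffIntegers`), input of `GreenbergSelmer.exists_cofree_coordinates`.

References: [Greenberg1989] §1 p. 98 (1)–(4); [EmertonPollackWeston2006] §3.1 (eq:ordes); [Wiles1988] pp. 562–563.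
-/

noncomputable section

open scoped MatrixGroups Matrix
open NumberField IsDedekindDomain Field Module
open Literature.NumberTheory.GaloisRepresentations
open Literature.NumberTheory.EllipticCurves.Hida2000_thm326_ordinary_unitRoot

namespace Literature.NumberTheory.EllipticCurves.GreenbergSelmer

universe u

variable {K : Type u} [Field K] [NumberField K]
variable {𝒪 : Type u} [CommRing 𝒪] [IsDomain 𝒪] [IsPrincipalIdealRing 𝒪] [TopologicalSpace 𝒪]

omit [TopologicalSpace 𝒪] in
/-- A submodule of `𝒪²` of `finrank 1` over a PID is `𝒪 · ℓ` for a torsion-free generator `ℓ` (free of rank one,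
`Submodule.basisOfPid`). [cite: Greenberg1989, §1 p. 98 (1)] -/
private theorem exists_eq_span_singleton_of_finrank_eq_one (N : Submodule 𝒪 (Fin 2 → 𝒪)) (hN : finrank 𝒪 N = 1) :
    ∃ ℓ : Fin 2 → 𝒪, N = Submodule.span 𝒪 {ℓ} ∧ ∀ t : 𝒪, t • ℓ = 0 → t = 0 := by
  obtain ⟨n, b⟩ := Submodule.basisOfPid (Pi.basisFun 𝒪 (Fin 2)) N
  have hn : n = 1 := by
    have h := finrank_eq_card_basis b
    rw [hN, Fintype.card_fin] at h
    exact h.symm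
  subst hn
  refine ⟨(b 0 : Fin 2 → 𝒪), ?_, fun t ht ↦ ?_⟩
  · apply le_antisymm
    · intro x hx
      have hx' : (⟨x, hx⟩ : N) ∈ Submodule.span 𝒪 (Set.range b) := by rw [b.span_eq]; trivial
      rw [show Set.range b = {b 0} from by
        ext y; simp only [Set.mem_range, Set.mem_singleton_iff]
        exact ⟨fun ⟨i, hi⟩ ↦ by rw [Subsingleton.elim i 0] at hi; exact hi.symm, fun h ↦ ⟨0, h.symm⟩⟩,
        Submodule.mem_span_singleton] at hx'
      obtain ⟨t, ht⟩ := hx'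
      exact Submodule.mem_span_singleton.mpr ⟨t, by rw [← Submodule.coe_smul, ht]⟩
    · rw [Submodule.span_singleton_le_iff_mem]; exact (b 0).2
  · have h1 : t • b 0 = 0 := Subtype.ext (by rw [Submodule.coe_smul, ht, Submodule.coe_zero])
    have h2 := b.linearIndependent
    rw [Fintype.linearIndependent_iff] at h2
    exact h2 (fun _ ↦ t) (by rw [Fin.sum_univ_one, h1]) 0

/-- **An ordinary filtration over a PID comes from an integral ordinary frame**: there is `Q₀ ∈ GL₂(𝒪)` with
`(Q₀⁻¹ρ(σ)Q₀)₁₀ = 0` for all `σ ∈ Γ_{K_v}` and `(Q₀⁻¹ρ(σ)Q₀)₁₁ = 1` for `σ` in the inertia group.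
[cite: Greenberg1989, §1 p. 98 (1), (4)] [cite: EmertonPollackWeston2006, §3.1 (eq:ordes)] -/
theorem OrdinaryFiltration.exists_integralFrame (ρ : FramedGaloisRep K 𝒪 2) (v : HeightOneSpectrum (𝓞 K))
    (P : OrdinaryFiltration ρ v) :
    ∃ Q₀ : GL (Fin 2) 𝒪, ∀ σ : absoluteGaloisGroup (v.adicCompletion K),
      (Q₀⁻¹ * ρ.toLocal v σ * Q₀).val 1 0 = 0 ∧
      (σ ∈ absInertia (v.adicCompletion K) → (Q₀⁻¹ * ρ.toLocal v σ * Q₀).val 1 1 = 1) := by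
  classical
  -- generators `ℓ` of `T⁺` and `c` of a complement
  obtain ⟨ℓ, hℓ, hℓtf⟩ := exists_eq_span_singleton_of_finrank_eq_one P.plus P.finrank_eq_one
  obtain ⟨C, hC⟩ := P.exists_isCompl
  have hCrank : finrank 𝒪 C = 1 := by
    -- `𝒪² ≃ T⁺ × C`, both free (submodules of a free module over a PID)
    obtain ⟨n₁, b₁⟩ := Submodule.basisOfPid (Pi.basisFun 𝒪 (Fin 2)) P.plus
    obtain ⟨n₂, b₂⟩ := Submodule.basisOfPid (Pi.basisFun 𝒪 (Fin 2)) C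
    haveI := Module.Free.of_basis b₁
    haveI := Module.Free.of_basis b₂
    haveI := Module.Finite.of_basis b₁
    haveI := Module.Finite.of_basis b₂
    have h := (Submodule.prodEquivOfIsCompl P.plus C hC).finrank_eq
    rw [Module.finrank_prod, P.finrank_eq_one, Module.finrank_fin_fun] at h
    omega
  obtain ⟨c, hc, hctf⟩ := exists_eq_span_singleton_of_finrank_eq_one C hCrank
  -- `(ℓ, c)` is a basis of `𝒪²`
  have hli : LinearIndependent 𝒪 ![ℓ, c] := by
    refine Fintype.linearIndependent_iff.mpr fun t ht ↦ ?_
    simp only [Fin.sum_univ_two, Matrix.cons_val_zero, Matrix.cons_val_one] at ht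
    have h0 : t 0 • ℓ ∈ P.plus := hℓ ▸ Submodule.smul_mem _ _ (Submodule.mem_span_singleton_self ℓ)
    have h1 : t 1 • c ∈ C := hc ▸ Submodule.smul_mem _ _ (Submodule.mem_span_singleton_self c)
    have heq : t 0 • ℓ = -(t 1 • c) := eq_neg_of_add_eq_zero_left ht
    have hmem : t 0 • ℓ ∈ P.plus ⊓ C := ⟨h0, by rw [heq]; exact C.neg_mem h1⟩
    rw [hC.inf_eq_bot, Submodule.mem_bot] at hmem
    have ht0 : t 0 = 0 := hℓtf _ hmem
    have ht1 : t 1 = 0 := hctf _ (by rw [ht0, zero_smul, zero_add] at ht; exact ht)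
    intro i; fin_cases i <;> assumption
  have hsp : ⊤ ≤ Submodule.span 𝒪 (Set.range ![ℓ, c]) := by
    have hr : Set.range ![ℓ, c] = {ℓ, c} := by
      ext y
      simp only [Set.mem_range, Set.mem_insert_iff, Set.mem_singleton_iff]
      constructor
      · rintro ⟨i, rfl⟩; fin_cases i <;> simp
      · rintro (rfl | rfl); exacts [⟨0, rfl⟩, ⟨1, rfl⟩]
    rw [hr, Submodule.span_insert, ← hℓ, ← hc, hC.sup_eq_top]
  let b : Basis (Fin 2) 𝒪 (Fin 2 → 𝒪) := Basis.mk hli hsp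
  have hb : ∀ j, (b j : Fin 2 → 𝒪) = ![ℓ, c] j := fun j ↦ Basis.mk_apply hli hsp j
  -- the frame `Q₀ = (ℓ | c)`
  haveI : Invertible ((Pi.basisFun 𝒪 (Fin 2)).toMatrix b) := (Pi.basisFun 𝒪 (Fin 2)).invertibleToMatrix b
  let Q₀ : GL (Fin 2) 𝒪 := unitOfInvertible ((Pi.basisFun 𝒪 (Fin 2)).toMatrix b)
  have hQ₀ : ∀ i j, (Q₀ : Matrix (Fin 2) (Fin 2) 𝒪) i j = ![ℓ, c] j i := fun i j ↦ by
    rw [show (Q₀ : Matrix (Fin 2) (Fin 2) 𝒪) = (Pi.basisFun 𝒪 (Fin 2)).toMatrix b from val_unitOfInvertible _,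
      Basis.toMatrix_apply, Pi.basisFun_repr, hb]
  have hcol0 : (fun i ↦ (Q₀ : Matrix (Fin 2) (Fin 2) 𝒪) i 0) = ℓ := funext fun i ↦ by rw [hQ₀]; rfl
  have hcol1 : (fun i ↦ (Q₀ : Matrix (Fin 2) (Fin 2) 𝒪) i 1) = c := funext fun i ↦ by rw [hQ₀]; rfl
  refine ⟨Q₀, fun σ ↦ ?_⟩
  set R : Matrix (Fin 2) (Fin 2) 𝒪 :=
    ((ρ (absGaloisRestrict K (v.adicCompletion K) σ) : GL (Fin 2) 𝒪) : Matrix (Fin 2) (Fin 2) 𝒪) with hR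
  -- `ρ(σ) ℓ = a ℓ`
  have hstab : R *ᵥ ℓ ∈ P.plus := by
    have h := P.smul_mem σ (y := ℓ) (hℓ ▸ Submodule.mem_span_singleton_self ℓ)
    rwa [FramedRep.toRepresentation_apply_apply] at h
  rw [hℓ, Submodule.mem_span_singleton] at hstab
  obtain ⟨a, ha⟩ := hstab
  have h10 := (conj_apply_col_zero_of_mulVec_frameCol_eq_smul R Q₀ (a := a) (by rw [hcol0, ha])).1
  refine ⟨?_, fun hσ ↦ ?_⟩
  · simpa [hR, Units.val_mul] using h10
  · -- `ρ(σ) c = c + s ℓ` for `σ` in inertia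
    have hun := P.unramified σ hσ c
    rw [FramedRep.toRepresentation_apply_apply, ← hR, hℓ, Submodule.mem_span_singleton] at hun
    obtain ⟨s, hs⟩ := hun
    have hRc : R *ᵥ c = s • ℓ + c := by rw [hs, sub_add_cancel]
    -- read the coordinate `1` in the frame
    have h1 := mulVec_frameCol_eq R Q₀ 1
    rw [hcol0, hcol1, hRc] at h1
    have h2 := congrArg (fun z ↦ (((Q₀⁻¹ : GL (Fin 2) 𝒪) : Matrix (Fin 2) (Fin 2) 𝒪) *ᵥ z) 1) h1
    simp only [Matrix.mulVec_add, Matrix.mulVec_smul, Pi.add_apply, Pi.smul_apply, smul_eq_mul] at h2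
    rw [← hcol0, ← hcol1, inv_mulVec_frameCol, inv_mulVec_frameCol] at h2
    simp only [Matrix.one_apply_eq, Matrix.one_apply_ne (show (1 : Fin 2) ≠ 0 by decide), mul_zero, mul_one,
      zero_add] at h2
    have h3 : (((Q₀⁻¹ : GL (Fin 2) 𝒪) : Matrix (Fin 2) (Fin 2) 𝒪) * R * (Q₀ : Matrix (Fin 2) (Fin 2) 𝒪)) 1 1 = 1 := h2.symm
    simpa [hR, Units.val_mul] using h3

end Literature.NumberTheory.EllipticCurves.GreenbergSelmer

end
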